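import Literature.Analysis.FluidPDE.JiaSverak2013Lemma8WindowBounds
import Literature.Analysis.FluidPDE.JiaSverak2013Lemma8RemainderBound
import Literature.Analysis.FluidPDE.JiaSverak2013Lemma8Layer
import Literature.Analysis.FluidPDE.HeatFlowGigaL5
import Literature.Analysis.FluidPDE.NSSereginMildStabilityTools
import HarnessLib

/-!
# The uniform initial layer of local Leray solutions with `L³` data on short strips `(0, T₀)`,
# `T₀ ≤ 1` (Jia–Šverák 2013, Lemma 8 = Seregin 2012, (2.13), slab form, uniformly in the length)

Analysis/FluidPDE proof file (theorems only: no definition, no named fact, no `sorry`) on the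
line of the named facts `Literature.Analysis.FluidPDE.seregin_regular_of_liminf_L3`,
`….seregin_L3_blowup_mild` (Lemarié-Rieusset 2016, Thm. 15.5) and `….seregin_L3_blowup`
(ns.S08), which the accepted `NSSereginBlowupCore.lean` (Seregin's own architecture, nothing
beyond the blow-up time) reduces to ONE hypothesis `hSlab`: the almost-everywhere initial layer
`‖u(t) − e^{tΔ}u₀‖_{L²(B(x₀,1))} ≤ h(t)` of local Leray solutions `(u, p)` on slabs `(0,T) × ℝ³`
with `L³` data, `‖u₀‖₃ ≤ M`, valid for a.e. `t < min T S₁(M)` with `h = h_M` **independent of the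
length `T` of the slab** (H. Jia, V. Šverák, SIAM J. Math. Anal. 45 (2013) = arXiv:1201.1592,
Lemma 8; G. Seregin, Comm. Math. Phys. 312 (2012), §2 (2.13)).

The tree proves the estimate on the **unit** strip with the a priori inputs as hypotheses
(`slab_ae_layer_unitStrip`, `NSSereginEnergySlabLayer.lean`: energies `≤ E` a.e., dissipation
`≤ A`, pressure `≤ Π` in `L^{3/2}` on `(0,1) × B(x₀,3)`). The sub-slabs of a Kato solution fed to
`hSlab` (`katoLayerAE_of_slabLayer`) may be arbitrarily short and cannot be extended in time, and
the Navier–Stokes scaling to unit length spoils the uniformity in the length; so this file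
re-runs the unit-strip proof on a strip `(0, T₀)`, `0 < T₀ ≤ 1`, keeping the majorant
`g = g_{M,E,A,Π}` literally the same function (hence independent of `T₀`):

* `decay_of_window_strip` — the real-variable layer (`decay_of_window`, Lebesgue points and
  Grönwall) on `(0, T₀)`: the windowed inequalities for windows `4δ ≤ τ < T₀` give
  `Y(τ) ≤ a(τ) exp(1 + K₀ ∫₀¹ P)` for a.e. `τ ∈ (0, T₀)`. Proof: at a fixed `τ < T₀` every kernel
  of the window lives in `(0, τ]`, so the accepted `le_of_window_at_lebesguePoint` applies to the
  extension of `Y` by zero; the Grönwall half is the accepted one on `[0, T₀]`.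
* `slab_ae_layer_strip` — Jia–Šverák's Lemma 8 on `(0, T₀) × ℝ³`, `T₀ ≤ 1`, inputs on
  `(0,T₀) × B(x₀,3)`; verbatim `slab_ae_layer_unitStrip` (windowed energy bound
  `IsLocalLeraySolutionOn.windowed_energy_bound`, `remainder_integral_bound`, Giga's `L⁵` bound)
  with `decay_of_window_strip` in place of `decay_of_window`.

## References

* H. Jia, V. Šverák, SIAM J. Math. Anal. 45 (2013) 1448–1459 = arXiv:1201.1592, Lemma 8 (p. 7).
  [JiaSverak2013]
* G. Seregin, Comm. Math. Phys. 312 (2012) 833–845 = arXiv:1104.3615, §2 (2.11)–(2.13).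
  [Seregin2012CMP]
* P. G. Lemarié-Rieusset, *The Navier–Stokes problem in the 21st century* (2016), Thm. 14.7,
  proof pp. 515–518; Thm. 15.5. [LemarieRieusset2016]
-/

noncomputable section

open MeasureTheory TopologicalSpace Set Function Filter Metric InnerProductSpace
open _root_.Topology
open scoped ENNReal NNReal RealInnerProductSpace

namespace Literature.Analysis.FluidPDE

open FunctionSpaces

/-! ## The real-variable layer on a short strip -/

section RealVariable

/-- **From the windowed energy bound to the decay at almost every time, on a strip `(0, T₀)`,
`T₀ ≤ 1`** (the accepted `decay_of_window` with the unit interval replaced by `(0, T₀)`;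
Jia–Šverák 2013, proof of Lemma 8, Grönwall step). Let `Y ≥ 0` be measurable and a.e. bounded
on `(0,T₀)` with `Y(t) → 0` as `t → 0⁺`, `P ≥ 0` with `∫₀¹ P < ∞`, `K₀ ≥ 0`, `a ≥ 0`
non-decreasing, and assume the windowed inequalities
`∫ ρ⁻_{δ,τ} Y ≤ ∫ ρ⁺_δ Y + ∫ σ_{δ,τ} Y + K₀ ∫ σ_{δ,τ} P Y + a(τ)` for `0 < δ`, `4δ ≤ τ < T₀`.
Then `Y(τ) ≤ a(τ) exp (1 + K₀ ∫₀¹ P)` for a.e. `τ ∈ (0, T₀)`. At a fixed `τ < T₀` all kernels of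
the window are supported in `(0, τ]`, so the accepted `le_of_window_at_lebesguePoint` applies to
the extension `1_{(0,T₀)} Y` of `Y` by zero; the Grönwall half is that of `decay_of_window` on
`[0, T₀]`. [cite: JiaSverak2013, Lemma 8, proof (arXiv:1201.1592 p. 7)] -/
theorem decay_of_window_strip {Y P a : ℝ → ℝ} {Ybar K₀ T₀ : ℝ} (hT₀ : 0 < T₀) (hT₀1 : T₀ ≤ 1)
    (hY0 : ∀ t, 0 ≤ Y t) (hYm : AEStronglyMeasurable Y (volume.restrict (Ioo (0 : ℝ) T₀)))
    (hYb : ∀ᵐ t ∂(volume.restrict (Ioo (0 : ℝ) T₀)), Y t ≤ Ybar)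
    (hYlim : Tendsto Y (𝓝[>] 0) (𝓝 0))
    (hP0 : ∀ t, 0 ≤ P t) (hPfin : ∫⁻ t in Ioo (0 : ℝ) 1, ENNReal.ofReal (P t) < ∞)
    (hK₀ : 0 ≤ K₀) (ha0 : ∀ t, 0 ≤ a t) (hmono : Monotone a)
    (hwin : ∀ δ τ : ℝ, 0 < δ → 4 * δ ≤ τ → τ < T₀ →
      ∫ t, ((1 / δ) * deriv Real.smoothTransition ((τ - δ - t) / δ)) * Y t ≤
        (∫ t, ((1 / δ) * deriv Real.smoothTransition ((t - δ) / δ)) * Y t) +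
        (∫ t, timePlateau δ τ t * Y t) +
        K₀ * (∫⁻ t, ENNReal.ofReal (timePlateau δ τ t * (P t * Y t))).toReal + a τ) :
    ∀ᵐ τ ∂(volume.restrict (Ioo (0 : ℝ) T₀)),
      Y τ ≤ a τ * Real.exp (1 + K₀ * (∫⁻ t in Ioo (0 : ℝ) 1, ENNReal.ofReal (P t)).toReal) := by
  have hsub₀ : Ioo (0 : ℝ) T₀ ⊆ Ioo 0 1 := Ioo_subset_Ioo le_rfl hT₀1
  -- ### integrability of `Y` on `(0, T₀)`
  have hYbar : ∀ᵐ t ∂(volume.restrict (Ioo (0 : ℝ) T₀)), Y t ≤ max Ybar 0 :=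
    hYb.mono fun t ht => ht.trans (le_max_left _ _)
  have hYI : IntegrableOn Y (Ioo (0 : ℝ) T₀) volume := by
    refine Integrable.mono' (integrableOn_const (C := max Ybar 0)
      (by rw [Real.volume_Ioo]; exact ENNReal.ofReal_ne_top)) hYm ?_
    filter_upwards [hYbar] with t ht
    rw [Real.norm_eq_abs, abs_of_nonneg (hY0 t)]
    exact ht
  -- ### the extension of `Y` by zero beyond `T₀`
  set Y' : ℝ → ℝ := (Ioo (0 : ℝ) T₀).indicator Y with hY'
  have hY'0 : ∀ t, 0 ≤ Y' t := fun t => by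
    simp only [hY']
    exact indicator_nonneg (fun s _ => hY0 s) t
  have hIU : Integrable Y' volume := (integrable_indicator_iff measurableSet_Ioo).2 hYI
  have hY'I : IntegrableOn Y' (Ioo (0 : ℝ) 1) volume := hIU.integrableOn
  have hY'b : ∀ᵐ t ∂(volume.restrict (Ioo (0 : ℝ) 1)), Y' t ≤ max Ybar 0 := by
    have h1 : ∀ᵐ t ∂(volume : Measure ℝ), t ∈ Ioo (0 : ℝ) T₀ → Y t ≤ max Ybar 0 :=
      (ae_restrict_iff' measurableSet_Ioo).1 hYbar
    refine ae_restrict_of_ae (h1.mono fun t ht => ?_)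
    by_cases htI : t ∈ Ioo (0 : ℝ) T₀
    · simp only [hY']; rw [indicator_of_mem htI]; exact ht htI
    · simp only [hY']; rw [indicator_of_notMem htI]; exact le_max_right _ _
  have hY'lim : Tendsto Y' (𝓝[>] 0) (𝓝 0) := by
    refine hYlim.congr' ?_
    filter_upwards [Ioo_mem_nhdsGT hT₀] with t ht
    simp only [hY']; rw [indicator_of_mem ht]
  have hU' : (Ioo (0 : ℝ) 1).indicator Y' = Y' := by
    funext t
    by_cases ht : t ∈ Ioo (0 : ℝ) 1
    · rw [indicator_of_mem ht]
    · rw [indicator_of_notMem ht]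
      simp only [hY']
      rw [indicator_of_notMem fun h => ht (hsub₀ h)]
  have hLeb := IsUnifLocDoublingMeasure.ae_tendsto_average_norm_sub (μ := (volume : Measure ℝ))
    hIU.locallyIntegrable 2
  -- ### finiteness of `∫₀ᵗ P Y`, `t ≤ T₀`
  set LI : ℝ≥0∞ := ∫⁻ t in Ioo (0 : ℝ) 1, ENNReal.ofReal (P t) with hLI
  have hLIfin : LI ≠ ∞ := hPfin.ne
  have hLYfin : ∀ t : ℝ, t ≤ T₀ → ∫⁻ s in Ioo 0 t, ENNReal.ofReal (P s * Y s) < ∞ := by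
    intro t ht
    have hsub : Ioo (0 : ℝ) t ⊆ Ioo 0 T₀ := Ioo_subset_Ioo le_rfl ht
    have hb : ∀ᵐ s ∂(volume.restrict (Ioo 0 t)),
        ENNReal.ofReal (P s * Y s) ≤ ENNReal.ofReal (P s) * ENNReal.ofReal (max Ybar 0) := by
      filter_upwards [ae_restrict_of_ae_restrict_of_subset hsub hYbar] with s hs
      rw [ENNReal.ofReal_mul (hP0 s)]
      exact mul_le_mul' le_rfl (ENNReal.ofReal_le_ofReal hs)
    calc ∫⁻ s in Ioo 0 t, ENNReal.ofReal (P s * Y s)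
        ≤ ∫⁻ s in Ioo 0 t, ENNReal.ofReal (P s) * ENNReal.ofReal (max Ybar 0) := lintegral_mono_ae hb
      _ = (∫⁻ s in Ioo 0 t, ENNReal.ofReal (P s)) * ENNReal.ofReal (max Ybar 0) :=
          lintegral_mul_const' _ _ ENNReal.ofReal_ne_top
      _ < ∞ := ENNReal.mul_lt_top
          ((lintegral_mono_set (hsub.trans hsub₀)).trans_lt hPfin) ENNReal.ofReal_lt_top
  -- ### (A) the integral inequality at a.e. `τ ∈ (0, T₀)`
  have hA : ∀ᵐ τ ∂(volume.restrict (Ioo (0 : ℝ) T₀)), Y τ ≤ a τ + (∫ t in Ioo 0 τ, Y t) +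
      K₀ * (∫⁻ t in Ioo 0 τ, ENNReal.ofReal (P t * Y t)).toReal := by
    filter_upwards [ae_restrict_of_ae (s := Ioo (0 : ℝ) T₀) hLeb, ae_restrict_mem measurableSet_Ioo]
      with τ hτL hτI
    have hτ1 : τ ∈ Ioo (0 : ℝ) 1 := hsub₀ hτI
    -- the windowed inequalities at `τ` for `Y'` are those for `Y`
    have hwin' : ∀ δ : ℝ, 0 < δ → 4 * δ ≤ τ →
        ∫ t, ((1 / δ) * deriv Real.smoothTransition ((τ - δ - t) / δ)) * Y' t ≤
          (∫ t, ((1 / δ) * deriv Real.smoothTransition ((t - δ) / δ)) * Y' t) +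
          (∫ t, timePlateau δ τ t * Y' t) +
          K₀ * (∫⁻ t, ENNReal.ofReal (timePlateau δ τ t * (P t * Y' t))).toReal + a τ := by
      intro δ hδ hδτ
      have eF : (fun t => ((1 / δ) * deriv Real.smoothTransition ((τ - δ - t) / δ)) * Y' t) =
          fun t => ((1 / δ) * deriv Real.smoothTransition ((τ - δ - t) / δ)) * Y t := by
        funext t
        by_cases ht : t ∈ Icc (τ - 2 * δ) (τ - δ)
        · have htI : t ∈ Ioo (0 : ℝ) T₀ :=
            ⟨by linarith [ht.1], by linarith [ht.2, hτI.2]⟩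
          simp only [hY']; rw [indicator_of_mem htI]
        · rw [plateauFall_eq_zero_of_notMem hδ ht, zero_mul, zero_mul]
      have eR : (fun t => ((1 / δ) * deriv Real.smoothTransition ((t - δ) / δ)) * Y' t) =
          fun t => ((1 / δ) * deriv Real.smoothTransition ((t - δ) / δ)) * Y t := by
        funext t
        by_cases ht : t ∈ Icc δ (2 * δ)
        · have htI : t ∈ Ioo (0 : ℝ) T₀ :=
            ⟨by linarith [ht.1], by linarith [ht.2, hτI.2]⟩
          simp only [hY']; rw [indicator_of_mem htI]
        · rw [plateauRise_eq_zero_of_notMem hδ ht, zero_mul, zero_mul]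
      have eS : (fun t => timePlateau δ τ t * Y' t) = fun t => timePlateau δ τ t * Y t := by
        funext t
        by_cases ht : t ∈ Ioo δ (τ - δ)
        · have htI : t ∈ Ioo (0 : ℝ) T₀ :=
            ⟨by linarith [ht.1], by linarith [ht.2, hτI.2]⟩
          simp only [hY']; rw [indicator_of_mem htI]
        · rw [timePlateau_eq_zero_of_notMem hδ ht, zero_mul, zero_mul]
      have eL : (fun t => ENNReal.ofReal (timePlateau δ τ t * (P t * Y' t))) =
          fun t => ENNReal.ofReal (timePlateau δ τ t * (P t * Y t)) := by
        funext t
        by_cases ht : t ∈ Ioo δ (τ - δ)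
        · have htI : t ∈ Ioo (0 : ℝ) T₀ :=
            ⟨by linarith [ht.1], by linarith [ht.2, hτI.2]⟩
          simp only [hY']; rw [indicator_of_mem htI]
        · rw [timePlateau_eq_zero_of_notMem hδ ht, zero_mul, zero_mul]
      rw [eF, eR, eS, eL]
      exact hwin δ τ hδ hδτ hτI.2
    have hLeb' : ∀ (w δ : ℕ → ℝ), Tendsto δ atTop (𝓝[>] 0) →
        (∀ᶠ j in atTop, τ ∈ closedBall (w j) (2 * δ j)) →
        Tendsto (fun j => ⨍ y in closedBall (w j) (δ j),
          ‖(Ioo (0 : ℝ) 1).indicator Y' y - (Ioo (0 : ℝ) 1).indicator Y' τ‖ ∂volume) atTop (𝓝 0) := by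
      rw [hU']
      exact fun w δ hδ hm => hτL w δ hδ hm
    have h := le_of_window_at_lebesguePoint (Y := Y') (P := P) (Ybar := max Ybar 0) (K₀ := K₀)
      (r := a τ) hY'0 hY'I hY'b hY'lim hP0 hPfin hK₀ hτ1 hLeb' hwin'
    -- back to `Y`
    have e0 : Y' τ = Y τ := by simp only [hY']; rw [indicator_of_mem hτI]
    have e1 : ∫ t in Ioo 0 τ, Y' t = ∫ t in Ioo 0 τ, Y t := by
      refine setIntegral_congr_fun measurableSet_Ioo fun t ht => ?_
      have htI : t ∈ Ioo (0 : ℝ) T₀ := ⟨ht.1, ht.2.trans hτI.2⟩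
      simp only [hY']; rw [indicator_of_mem htI]
    have e2 : ∫⁻ t in Ioo 0 τ, ENNReal.ofReal (P t * Y' t) =
        ∫⁻ t in Ioo 0 τ, ENNReal.ofReal (P t * Y t) := by
      refine setLIntegral_congr_fun measurableSet_Ioo fun t ht => ?_
      have htI : t ∈ Ioo (0 : ℝ) T₀ := ⟨ht.1, ht.2.trans hτI.2⟩
      simp only [hY']; rw [indicator_of_mem htI]
    rw [e0, e1, e2] at h
    exact h
  -- ### (B) Grönwall on the good set
  set G : Set ℝ := {t | t ∈ Ioo (0 : ℝ) T₀ ∧ Y t ≤ max Ybar 0 ∧ Y t ≤ a t + (∫ s in Ioo 0 t, Y s) +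
      K₀ * (∫⁻ s in Ioo 0 t, ENNReal.ofReal (P s * Y s)).toReal} with hG
  have hGae : ∀ᵐ t ∂(volume.restrict (Ioo (0 : ℝ) T₀)), t ∈ G := by
    filter_upwards [ae_restrict_mem measurableSet_Ioo, hYbar, hA] with t h1 h2 h3
    exact ⟨h1, h2, h3⟩
  set α : ℝ → ℝ≥0∞ := fun t => ENNReal.ofReal (1 + K₀ * P t) with hα
  set φ : ℝ → ℝ≥0∞ := G.indicator fun t => ENNReal.ofReal (Y t) with hφ
  have hαle : ∀ S, S ≤ T₀ → ∫⁻ t in Ioo 0 S, α t ≤ ENNReal.ofReal 1 + ENNReal.ofReal K₀ * LI := by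
    intro S hS
    have hS1 : S ≤ 1 := hS.trans hT₀1
    have e : ∀ t, α t = ENNReal.ofReal 1 + ENNReal.ofReal K₀ * ENNReal.ofReal (P t) := fun t => by
      simp only [hα]
      rw [ENNReal.ofReal_add zero_le_one (mul_nonneg hK₀ (hP0 t)), ENNReal.ofReal_mul hK₀]
    simp_rw [e]
    rw [lintegral_add_left measurable_const, lintegral_const_mul' _ _ ENNReal.ofReal_ne_top,
      setLIntegral_const]
    have hv : ENNReal.ofReal 1 * volume (Ioo (0 : ℝ) S) ≤ ENNReal.ofReal 1 := by
      rw [Real.volume_Ioo, sub_zero]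
      calc ENNReal.ofReal 1 * ENNReal.ofReal S ≤ ENNReal.ofReal 1 * ENNReal.ofReal 1 :=
            mul_le_mul' le_rfl (ENNReal.ofReal_le_ofReal hS1)
        _ = ENNReal.ofReal 1 := by simp
    have hm : ∫⁻ t in Ioo 0 S, ENNReal.ofReal (P t) ≤ LI :=
      lintegral_mono_set (Ioo_subset_Ioo le_rfl hS1)
    exact add_le_add hv (mul_le_mul' le_rfl hm)
  have hTop : ENNReal.ofReal 1 + ENNReal.ofReal K₀ * LI ≠ ∞ :=
    ENNReal.add_ne_top.2 ⟨ENNReal.ofReal_ne_top, ENNReal.mul_ne_top ENNReal.ofReal_ne_top hLIfin⟩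
  have hmain : ∀ S ∈ G, Y S ≤ a S * Real.exp (1 + K₀ * LI.toReal) := by
    intro S hS
    have hSG := hS
    obtain ⟨hSI, -, -⟩ := hS
    have hST : S ≤ T₀ := hSI.2.le
    have hφM : ∀ t ∈ Icc 0 S, φ t ≤ ENNReal.ofReal (max Ybar 0) := by
      intro t _
      simp only [hφ]
      by_cases ht : t ∈ G
      · rw [indicator_of_mem ht]
        exact ENNReal.ofReal_le_ofReal ht.2.1
      · rw [indicator_of_notMem ht]
        exact zero_le
    have hαfin : ∫⁻ t in Ioo 0 S, α t ≠ ⊤ := ne_top_of_le_ne_top hTop (hαle S hST)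
    have hφineq : ∀ t ∈ Icc 0 S, φ t ≤ ENNReal.ofReal (a S) + ∫⁻ s in Ioo 0 t, α s * φ s := by
      intro t ht
      by_cases htG : t ∈ G
      swap
      · simp only [hφ]
        rw [indicator_of_notMem htG]
        exact zero_le
      have hmem := htG
      obtain ⟨htI, -, htineq⟩ := htG
      have htT : t ≤ T₀ := htI.2.le
      have hsub : Ioo (0 : ℝ) t ⊆ Ioo 0 T₀ := Ioo_subset_Ioo le_rfl htT
      simp only [hφ]
      rw [indicator_of_mem hmem]
      have hYIt : IntegrableOn Y (Ioo 0 t) volume := hYI.mono_set hsub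
      have hSY0 : 0 ≤ ∫ s in Ioo 0 t, Y s := setIntegral_nonneg measurableSet_Ioo fun s _ => hY0 s
      have hLYt : ∫⁻ s in Ioo 0 t, ENNReal.ofReal (P s * Y s) < ∞ := hLYfin t htT
      have e1 : ENNReal.ofReal (∫ s in Ioo 0 t, Y s) = ∫⁻ s in Ioo 0 t, ENNReal.ofReal (Y s) :=
        ofReal_integral_eq_lintegral_ofReal hYIt (ae_of_all _ fun s => hY0 s)
      have e2 : ENNReal.ofReal (K₀ * (∫⁻ s in Ioo 0 t, ENNReal.ofReal (P s * Y s)).toReal) =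
          ENNReal.ofReal K₀ * ∫⁻ s in Ioo 0 t, ENNReal.ofReal (P s * Y s) := by
        rw [ENNReal.ofReal_mul hK₀, ENNReal.ofReal_toReal hLYt.ne]
      have hmeasY : AEMeasurable (fun s => ENNReal.ofReal (Y s)) (volume.restrict (Ioo 0 t)) :=
        (hYm.mono_measure (Measure.restrict_mono hsub le_rfl)).aemeasurable.ennreal_ofReal
      have e3 : (∫⁻ s in Ioo 0 t, ENNReal.ofReal (Y s)) +
          ENNReal.ofReal K₀ * ∫⁻ s in Ioo 0 t, ENNReal.ofReal (P s * Y s) =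
          ∫⁻ s in Ioo 0 t, α s * ENNReal.ofReal (Y s) := by
        rw [← lintegral_const_mul' _ _ ENNReal.ofReal_ne_top, ← lintegral_add_left' hmeasY]
        refine lintegral_congr fun s => ?_
        simp only [hα]
        rw [ENNReal.ofReal_add zero_le_one (mul_nonneg hK₀ (hP0 s)), ENNReal.ofReal_one, add_mul,
          one_mul, ENNReal.ofReal_mul hK₀, ENNReal.ofReal_mul (hP0 s), mul_assoc]
      have e4 : ∫⁻ s in Ioo 0 t, α s * ENNReal.ofReal (Y s) = ∫⁻ s in Ioo 0 t, α s * φ s := by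
        refine lintegral_congr_ae ?_
        filter_upwards [ae_restrict_of_ae_restrict_of_subset hsub hGae] with s hs
        simp only [hφ]
        rw [indicator_of_mem hs]
      calc ENNReal.ofReal (Y t)
          ≤ ENNReal.ofReal (a t + (∫ s in Ioo 0 t, Y s) +
              K₀ * (∫⁻ s in Ioo 0 t, ENNReal.ofReal (P s * Y s)).toReal) :=
            ENNReal.ofReal_le_ofReal htineq
        _ = ENNReal.ofReal (a t) + (∫⁻ s in Ioo 0 t, ENNReal.ofReal (Y s)) +
              ENNReal.ofReal K₀ * ∫⁻ s in Ioo 0 t, ENNReal.ofReal (P s * Y s) := by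
            rw [ENNReal.ofReal_add (add_nonneg (ha0 t) hSY0) (by positivity),
              ENNReal.ofReal_add (ha0 t) hSY0, e1, e2]
        _ ≤ ENNReal.ofReal (a S) + ∫⁻ s in Ioo 0 t, α s * φ s := by
            rw [add_assoc, e3, e4]
            exact add_le_add (ENNReal.ofReal_le_ofReal (hmono ht.2)) le_rfl
    have hGr := lintegral_gronwall_le (S := S) ENNReal.ofReal_ne_top ENNReal.ofReal_ne_top hφM hαfin
      hφineq S ⟨hSI.1.le, le_rfl⟩
    have hφS : φ S = ENNReal.ofReal (Y S) := by
      simp only [hφ]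
      rw [indicator_of_mem hSG]
    rw [hφS] at hGr
    have hexp : (∫⁻ s in Ioo 0 S, α s).toReal ≤ 1 + K₀ * LI.toReal := by
      have h := ENNReal.toReal_mono hTop (hαle S hST)
      rwa [ENNReal.toReal_add ENNReal.ofReal_ne_top (ENNReal.mul_ne_top ENNReal.ofReal_ne_top hLIfin),
        ENNReal.toReal_mul, ENNReal.toReal_ofReal zero_le_one, ENNReal.toReal_ofReal hK₀] at h
    have hfin : Y S ≤ a S * Real.exp (∫⁻ s in Ioo 0 S, α s).toReal := by
      rw [← ENNReal.ofReal_mul (ha0 S)] at hGr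
      exact (ENNReal.ofReal_le_ofReal_iff (mul_nonneg (ha0 S) (Real.exp_nonneg _))).1 hGr
    exact hfin.trans (mul_le_mul_of_nonneg_left (Real.exp_le_exp.2 hexp) (ha0 S))
  filter_upwards [hGae] with S hS using hmain S hS

end RealVariable

/-! ## Tools -/

section Tools

/-- `∫⁻ ‖g‖ₑ² ≤ (∫⁻ ‖g‖ₑ³)^{2/3} μ(univ)^{1/3}` (Hölder `(3/2, 3)` against `1`); private copy of the
tool of `JiaSverak2013Lemma8RemainderBound.lean`. [folklore] -/
private theorem lintegral_enorm_sq_le_cube_rpow' {X F : Type*} [MeasurableSpace X] {μ : Measure X}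
    [NormedAddCommGroup F] [MeasurableSpace F] [BorelSpace F] {g : X → F}
    (hg : AEStronglyMeasurable g μ) :
    ∫⁻ x, ‖g x‖ₑ ^ 2 ∂μ ≤ (∫⁻ x, ‖g x‖ₑ ^ 3 ∂μ) ^ (2 / 3 : ℝ) * (μ univ) ^ (1 / 3 : ℝ) := by
  have h := lintegral_mul_le_L32_L3 (μ := μ) (f := fun x => ‖g x‖ₑ ^ 2) (g := fun _ => 1)
    (hg.aemeasurable.enorm.pow_const _) aemeasurable_const
  simp only [mul_one, one_pow, lintegral_const, one_mul] at h
  have e : ∀ x, (‖g x‖ₑ ^ 2) ^ (3 / 2 : ℝ) = ‖g x‖ₑ ^ 3 := fun x => by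
    rw [← ENNReal.rpow_natCast _ 2, ← ENNReal.rpow_mul, ← ENNReal.rpow_natCast _ 3]; norm_num
  simp only [e] at h
  exact h

/-- `∫⁻ ‖f‖ₑ³ = ‖f‖₃³`. [folklore] -/
private theorem lintegral_enorm_pow_three_eq {X F : Type*} [MeasurableSpace X] {μ : Measure X}
    [NormedAddCommGroup F] (f : X → F) : ∫⁻ x, ‖f x‖ₑ ^ 3 ∂μ = eLpNorm f 3 μ ^ 3 := by
  have h1 : eLpNorm f 3 μ = (∫⁻ x, ‖f x‖ₑ ^ 3 ∂μ) ^ (1 / 3 : ℝ) := by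
    rw [eLpNorm_eq_lintegral_rpow_enorm_toReal (by norm_num) (by norm_num)]
    simp only [ENNReal.toReal_ofNat, ENNReal.rpow_ofNat]
  rw [h1, ← ENNReal.rpow_natCast _ 3, ← ENNReal.rpow_mul]
  norm_num

/-- On a set of finite measure, `∫⁻_B ‖g‖ₑ² ≤ ‖g‖₃² |B|^{1/3}`. [folklore] -/
private theorem setLIntegral_enorm_sq_le_eLpNorm_three_sq {F : Type*} [NormedAddCommGroup F]
    [MeasurableSpace F] [BorelSpace F] {g : EuclideanSpace ℝ (Fin 3) → F}
    {B : Set (EuclideanSpace ℝ (Fin 3))} (hg : AEStronglyMeasurable g (volume.restrict B)) :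
    ∫⁻ x in B, ‖g x‖ₑ ^ 2 ≤ eLpNorm g 3 volume ^ 2 * volume B ^ (1 / 3 : ℝ) := by
  have h1 := lintegral_enorm_sq_le_cube_rpow' (μ := volume.restrict B) hg
  rw [Measure.restrict_apply_univ] at h1
  refine h1.trans (mul_le_mul' ?_ le_rfl)
  have h2 : (∫⁻ x in B, ‖g x‖ₑ ^ 3) ≤ eLpNorm g 3 volume ^ 3 := by
    rw [← lintegral_enorm_pow_three_eq]
    exact lintegral_mono' Measure.restrict_le_self le_rfl
  calc (∫⁻ x in B, ‖g x‖ₑ ^ 3) ^ (2 / 3 : ℝ) ≤ (eLpNorm g 3 volume ^ 3) ^ (2 / 3 : ℝ) :=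
        ENNReal.rpow_le_rpow h2 (by norm_num)
    _ = eLpNorm g 3 volume ^ 2 := by
        rw [← ENNReal.rpow_natCast _ 3, ← ENNReal.rpow_mul, ← ENNReal.rpow_natCast _ 2]; norm_num

/-- `∫⁻_B ‖U - E‖ₑ² ≤ 2 ∫⁻_B ‖U - g‖ₑ² + 2 ∫⁻_B ‖E - g‖ₑ²` when the second difference is measurable.
[folklore] -/
private theorem setLIntegral_enorm_sub_sq_le {X F : Type*} [MeasurableSpace X] {μ : Measure X}
    [NormedAddCommGroup F] {U V g : X → F}
    (hm : AEMeasurable (fun x => ‖V x - g x‖ₑ ^ 2) μ) :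
    ∫⁻ x, ‖U x - V x‖ₑ ^ 2 ∂μ ≤ 2 * ∫⁻ x, ‖U x - g x‖ₑ ^ 2 ∂μ + 2 * ∫⁻ x, ‖V x - g x‖ₑ ^ 2 ∂μ := by
  have hpt : ∀ x, ‖U x - V x‖ₑ ^ 2 ≤ 2 * ‖U x - g x‖ₑ ^ 2 + 2 * ‖V x - g x‖ₑ ^ 2 := by
    intro x
    have h : ‖(U x - g x) - (V x - g x)‖ ^ 2 ≤ 2 * ‖U x - g x‖ ^ 2 + 2 * ‖V x - g x‖ ^ 2 := by
      nlinarith [norm_sub_le (U x - g x) (V x - g x), sq_nonneg (‖U x - g x‖ - ‖V x - g x‖),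
        norm_nonneg ((U x - g x) - (V x - g x)), norm_nonneg (U x - g x), norm_nonneg (V x - g x)]
    rw [sub_sub_sub_cancel_right] at h
    calc ‖U x - V x‖ₑ ^ 2 = ENNReal.ofReal (‖U x - V x‖ ^ 2) := by
          rw [← ofReal_norm, ENNReal.ofReal_pow (norm_nonneg _)]
      _ ≤ ENNReal.ofReal (2 * ‖U x - g x‖ ^ 2 + 2 * ‖V x - g x‖ ^ 2) := ENNReal.ofReal_le_ofReal h
      _ = 2 * ‖U x - g x‖ₑ ^ 2 + 2 * ‖V x - g x‖ₑ ^ 2 := by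
          rw [ENNReal.ofReal_add (by positivity) (by positivity), ENNReal.ofReal_mul zero_le_two,
            ENNReal.ofReal_mul zero_le_two, ENNReal.ofReal_pow (norm_nonneg _),
            ENNReal.ofReal_pow (norm_nonneg _), ofReal_norm, ofReal_norm, ENNReal.ofReal_ofNat]
  calc ∫⁻ x, ‖U x - V x‖ₑ ^ 2 ∂μ ≤ ∫⁻ x, (2 * ‖U x - g x‖ₑ ^ 2 + 2 * ‖V x - g x‖ₑ ^ 2) ∂μ :=
        lintegral_mono hpt
    _ = 2 * ∫⁻ x, ‖U x - g x‖ₑ ^ 2 ∂μ + 2 * ∫⁻ x, ‖V x - g x‖ₑ ^ 2 ∂μ := by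
        rw [lintegral_add_right' _ (hm.const_mul _), lintegral_const_mul' _ _ (by simp),
          lintegral_const_mul' _ _ (by simp)]

/-- `ENNReal.ofReal (∫ f) ≤ ∫⁻ ENNReal.ofReal f` for `f ≥ 0` (no integrability needed). [folklore] -/
private theorem ofReal_integral_le_lintegral_ofReal' {X : Type*} [MeasurableSpace X] {μ : Measure X}
    {f : X → ℝ} (hf : ∀ x, 0 ≤ f x) :
    ENNReal.ofReal (∫ x, f x ∂μ) ≤ ∫⁻ x, ENNReal.ofReal (f x) ∂μ := by
  rw [← Real.enorm_eq_ofReal (integral_nonneg hf)]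
  refine (enorm_integral_le_lintegral_enorm f).trans (le_of_eq (lintegral_congr fun x => ?_))
  exact Real.enorm_eq_ofReal (hf x)

end Tools
/-! ## The layer on a short strip -/

section Main

set_option maxHeartbeats 3200000 in
/-- **Jia–Šverák's Lemma 8 on a short strip `(0, T₀)`, `T₀ ≤ 1`, with a priori inputs on
cylinders of radius `3`, uniformly in `T₀`** (Jia–Šverák 2013, Lemma 8; Seregin 2012,
(2.11)–(2.13); Lemarié-Rieusset 2016, proof of Thm. 14.7, pp. 515–518). For `M, E, A, Π ≥ 0`
there is a monotone `g : ℝ → ℝ≥0` with `g(t) → 0` as `t → 0⁺` — the SAME function as in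
`slab_ae_layer_unitStrip`, in particular independent of `T₀` — such that for every
`0 < T₀ ≤ 1`, every local Leray solution `(u, p)` on `ℝ³ × (0,T₀)` with unit viscosity and datum
`u₀ ∈ L³`, `‖u₀‖₃ ≤ M`, and every centre `x₀` with `∫_{B(x₀,3)} |u(t)|² ≤ E` for a.e.
`t ∈ (0,T₀)`, `∫₀^{T₀}∫_{B(x₀,3)} |∇u|² ≤ A` for every weak spatial gradient `∇u` of `u` on the
strip, and `∫₀^{T₀}∫_{B(x₀,3)} |p|^{3/2} ≤ Π`: `‖u(t) − e^{tΔ}u₀‖_{L²(B(x₀,1))} ≤ g(t)` for a.e.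
`t ∈ (0,T₀)`. The proof is that of `slab_ae_layer_unitStrip`, verbatim, with
`decay_of_window_strip` in place of `decay_of_window` (the windowed energy bound
`IsLocalLeraySolutionOn.windowed_energy_bound` and the remainder bound
`remainder_integral_bound` are already stated on slabs of any length).
[cite: JiaSverak2013, Lemma 8 (arXiv:1201.1592 p. 7)] [cite: Seregin2012CMP, §2 (2.11)–(2.13)] [cite: LemarieRieusset2016, Thm. 14.7 proof (pp. 515–518)] -/
theorem slab_ae_layer_strip (M EM AM PM : ℝ≥0) :
    ∃ g : ℝ → ℝ≥0, Monotone g ∧ Tendsto g (𝓝[>] 0) (𝓝 0) ∧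
      ∀ (T₀ : ℝ) (u₀ : EuclideanSpace ℝ (Fin 3) → EuclideanSpace ℝ (Fin 3))
        (u : ℝ → EuclideanSpace ℝ (Fin 3) → EuclideanSpace ℝ (Fin 3))
        (p : ℝ → EuclideanSpace ℝ (Fin 3) → ℝ) (x₀ : EuclideanSpace ℝ (Fin 3)),
        0 < T₀ → T₀ ≤ 1 →
        MemLp u₀ 3 volume → eLpNorm u₀ 3 volume ≤ M → IsLocalLeraySolutionOn T₀ 1 u₀ u p →
        (∀ᵐ t ∂(volume.restrict (Ioo (0 : ℝ) T₀)), ∫⁻ x in ball x₀ 3, ‖u t x‖ₑ ^ 2 ≤ EM) →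
        (∀ G : ℝ → EuclideanSpace ℝ (Fin 3) → EuclideanSpace ℝ (Fin 3) →L[ℝ] EuclideanSpace ℝ (Fin 3),
          HasWeakSpatialGradientOn (slab (EuclideanSpace ℝ (Fin 3)) (Ioo 0 T₀) isOpen_Ioo) u G →
          ∫⁻ z in Ioo (0 : ℝ) T₀ ×ˢ ball x₀ 3, ENNReal.ofReal (frobeniusNormSq (G z.1 z.2)) ≤ AM) →
        (∫⁻ z in Ioo (0 : ℝ) T₀ ×ˢ ball x₀ 3, ‖p z.1 z.2‖ₑ ^ (3 / 2 : ℝ) ≤ PM) →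
        ∀ᵐ t ∂(volume.restrict (Ioo (0 : ℝ) T₀)),
          eLpNorm (u t - heatTest 1 u₀ t) 2 (volume.restrict (ball x₀ 1)) ≤ g t := by
  -- ### the constants
  obtain ⟨c₁, cΔ, hc₁, hcΔ, hcut⟩ := exists_cutoff_translate_bounds
  obtain ⟨K₀, hK₀, htri⟩ := two_mul_abs_integral_sq_mul_inner_apply_le (3 : ℝ)
  obtain ⟨CG, hCGtop, hGiga⟩ := lintegral_Ioi_eLpNorm_heatExtension_pow_five_le
    (E := EuclideanSpace ℝ (Fin 3)) (F := EuclideanSpace ℝ (Fin 3)) finrank_euclideanSpace_fin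
  obtain ⟨a, ha0, hmono, hlim, hrem⟩ := remainder_integral_bound M EM AM PM hc₁ hcΔ
  have hCGM : CG * (M : ℝ≥0∞) ^ 5 ≠ ⊤ := ENNReal.mul_ne_top hCGtop.ne (ENNReal.pow_ne_top ENNReal.coe_ne_top)
  set Kexp : ℝ := Real.exp (1 + K₀ * (CG * (M : ℝ≥0∞) ^ 5).toReal) with hKexp
  have hKexp0 : 0 ≤ Kexp := Real.exp_nonneg _
  refine ⟨fun t => (Real.sqrt (a t * Kexp)).toNNReal, fun t t' htt' => ?_, ?_, ?_⟩
  · -- monotone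
    exact Real.toNNReal_le_toNNReal (Real.sqrt_le_sqrt (mul_le_mul_of_nonneg_right (hmono htt') hKexp0))
  · -- `g(t) → 0`
    have h1 : Tendsto (fun t => a t * Kexp) (𝓝[>] 0) (𝓝 0) := by
      simpa using hlim.mul_const Kexp
    have h2 := ((continuous_real_toNNReal.comp Real.continuous_sqrt).tendsto 0).comp h1
    have h3 : (Real.toNNReal ∘ Real.sqrt) 0 = 0 := by simp
    rw [h3] at h2
    exact h2
  intro T₀ u₀ u p x₀ hT₀ hT₀1 hu₀ hM h1 hE1 hA3 hPi
  have hν : (0 : ℝ) < 1 := one_pos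
  have hdiv : IsWeaklyDivFree u₀ := h1.isWeaklyDivFree_datum hT₀
  -- ### the weak gradient carrying the local energy inequality
  obtain ⟨G', hG', hG'2, hLEI'⟩ := h1.suitable.localEnergy
  -- ### the objects `e`, `Y`, `P`
  set e : ℝ → EuclideanSpace ℝ (Fin 3) → EuclideanSpace ℝ (Fin 3) := fun t => heatFlow u₀ (1 * t)
    with hedef
  have he_app : ∀ t, heatFlow u₀ (1 * t) = e t := fun t => rfl
  set Y : ℝ → ℝ := fun t => ∫ x, cutoff (1 : ℝ) (x - x₀) ^ 2 * ‖u t x - e t x‖ ^ 2 with hYdef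
  set P : ℝ → ℝ := fun t => (eLpNorm (e t) 5 volume).toReal ^ 5 with hPdef
  set V : ℝ≥0∞ := volume (ball x₀ (3 : ℝ)) with hV
  have hVfin : V ≠ ⊤ := measure_ball_lt_top.ne
  have hV3fin : V ^ (1 / 3 : ℝ) ≠ ⊤ := ENNReal.rpow_ne_top_of_nonneg (by norm_num) hVfin
  -- facts on the caloric extension
  have he_pos : ∀ t, 0 < t → e t = UnboundedOperators.heatExtension u₀ (1 * t) := fun t ht => by
    rw [hedef]; exact heatFlow_of_pos u₀ (by linarith)
  have he3 : ∀ t, 0 ≤ t → eLpNorm (e t) 3 volume ≤ M := fun t ht =>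
    (eLpNorm_heatFlow_le_holds hu₀ (by norm_num) (by positivity : (0 : ℝ) ≤ 1 * t)).trans hM
  have he_cont : ∀ t, 0 < t → Continuous (e t) := fun t ht => by
    rw [he_pos t ht]
    exact (UnboundedOperators.contDiff_heatExtension_holds hu₀ (by norm_num) (by linarith)).continuous
  have hM2V : ∀ t, 0 < t → ∫⁻ x in ball x₀ 3, ‖e t x‖ₑ ^ 2 ≤ (M : ℝ≥0∞) ^ 2 * V ^ (1 / 3 : ℝ) := by
    intro t ht
    refine (setLIntegral_enorm_sq_le_eLpNorm_three_sq (he_cont t ht).aestronglyMeasurable).trans ?_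
    exact mul_le_mul' (pow_le_pow_left' (he3 t ht.le) 2) le_rfl
  -- θ facts
  have hθ1 : ∀ x, cutoff (1 : ℝ) (x - x₀) ^ 2 ≤ 1 := fun x =>
    pow_le_one₀ (cutoff_nonneg _ _) (cutoff_le_one _ _)
  have hθ0 : ∀ x, x ∉ ball x₀ 3 → cutoff (1 : ℝ) (x - x₀) = 0 := by
    intro x hx
    refine cutoff_eq_zero one_pos ?_
    rw [mem_ball, dist_eq_norm] at hx
    linarith [not_lt.1 hx]
  have hθone : ∀ x, x ∈ ball x₀ 1 → cutoff (1 : ℝ) (x - x₀) = 1 := by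
    intro x hx
    refine cutoff_eq_one one_pos ?_
    rw [mem_ball, dist_eq_norm] at hx
    exact hx.le
  -- ### `Y ≥ 0`, `ofReal Y ≤ ∫_{B₃} |w|²`
  have hY0 : ∀ t, 0 ≤ Y t := fun t => integral_nonneg fun x => by positivity
  have hYle : ∀ t, ENNReal.ofReal (Y t) ≤ ∫⁻ x in ball x₀ 3, ‖u t x - e t x‖ₑ ^ 2 := by
    intro t
    calc ENNReal.ofReal (Y t)
        ≤ ∫⁻ x, ENNReal.ofReal (cutoff (1 : ℝ) (x - x₀) ^ 2 * ‖u t x - e t x‖ ^ 2) :=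
          ofReal_integral_le_lintegral_ofReal' fun x => by positivity
      _ ≤ ∫⁻ x, (ball x₀ 3).indicator (fun x => ‖u t x - e t x‖ₑ ^ 2) x := by
          refine lintegral_mono fun x => ?_
          by_cases hx : x ∈ ball x₀ 3
          · rw [indicator_of_mem hx, ← ofReal_norm, ← ENNReal.ofReal_pow (norm_nonneg _)]
            exact ENNReal.ofReal_le_ofReal (mul_le_of_le_one_left (sq_nonneg _) (hθ1 x))
          · rw [indicator_of_notMem hx, hθ0 x hx]
            simp
      _ = ∫⁻ x in ball x₀ 3, ‖u t x - e t x‖ₑ ^ 2 := lintegral_indicator measurableSet_ball _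
  -- ### slices of `u`
  have hslice := ae_slice_aestronglyMeasurable_and_lintegral_ball_lt_top h1.aestronglyMeasurable
    (fun K hK => h1.sqIntegrable K hK)
  -- ### `Y` is measurable
  have hYm : AEStronglyMeasurable Y (volume.restrict (Ioo (0 : ℝ) T₀)) := by
    have hu1 : AEStronglyMeasurable (uncurry u) (volume.restrict (Ioo (0 : ℝ) T₀ ×ˢ univ)) :=
      h1.aestronglyMeasurable
    have he1 : AEStronglyMeasurable (uncurry e) (volume.restrict (Ioo (0 : ℝ) T₀ ×ˢ univ)) :=
      aestronglyMeasurable_uncurry_heatFlow hu₀ (by norm_num) hν T₀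
    have hθ : AEStronglyMeasurable (fun z : ℝ × EuclideanSpace ℝ (Fin 3) => cutoff (1 : ℝ) (z.2 - x₀) ^ 2)
        (volume.restrict (Ioo (0 : ℝ) T₀ ×ˢ univ)) :=
      (((contDiff_cutoff (E := EuclideanSpace ℝ (Fin 3)) (n := 0) 1).continuous.comp
        (continuous_snd.sub continuous_const)).pow 2).aestronglyMeasurable
    have hF : AEStronglyMeasurable (fun z : ℝ × EuclideanSpace ℝ (Fin 3) =>
        cutoff (1 : ℝ) (z.2 - x₀) ^ 2 * ‖u z.1 z.2 - e z.1 z.2‖ ^ 2)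
        ((volume.restrict (Ioo (0 : ℝ) T₀)).prod volume) := by
      rw [← volume_restrict_slab_eq]
      have h := hθ.mul ((hu1.sub he1).norm.pow 2)
      exact h
    exact hF.integral_prod_right'
  -- ### `Y` is a.e. bounded
  set Yb : ℝ≥0∞ := 2 * (EM : ℝ≥0∞) + 2 * ((M : ℝ≥0∞) ^ 2 * V ^ (1 / 3 : ℝ)) with hYb'
  have hYbfin : Yb ≠ ⊤ := ENNReal.add_ne_top.2 ⟨ENNReal.mul_ne_top (by simp) ENNReal.coe_ne_top,
    ENNReal.mul_ne_top (by simp) (ENNReal.mul_ne_top (ENNReal.pow_ne_top ENNReal.coe_ne_top) hV3fin)⟩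
  have hYb : ∀ᵐ t ∂(volume.restrict (Ioo (0 : ℝ) T₀)), Y t ≤ Yb.toReal := by
    filter_upwards [hslice, hE1, ae_restrict_mem measurableSet_Ioo] with t hst hEt ht
    refine (ENNReal.ofReal_le_iff_le_toReal hYbfin).1 ?_
    have hm : AEMeasurable (fun x => ‖e t x - (0 : EuclideanSpace ℝ (Fin 3))‖ₑ ^ 2)
        (volume.restrict (ball x₀ 3)) :=
      (((he_cont t ht.1).aestronglyMeasurable.sub aestronglyMeasurable_const).aemeasurable.enorm.pow_const _)
    calc ENNReal.ofReal (Y t) ≤ ∫⁻ x in ball x₀ 3, ‖u t x - e t x‖ₑ ^ 2 := hYle t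
      _ ≤ (2 * ∫⁻ x in ball x₀ 3, ‖u t x - 0‖ₑ ^ 2) + 2 * ∫⁻ x in ball x₀ 3, ‖e t x - 0‖ₑ ^ 2 :=
          setLIntegral_enorm_sub_sq_le hm
      _ ≤ 2 * (EM : ℝ≥0∞) + 2 * ((M : ℝ≥0∞) ^ 2 * V ^ (1 / 3 : ℝ)) := by
          simp only [sub_zero]
          exact add_le_add (mul_le_mul' le_rfl hEt) (mul_le_mul' le_rfl (hM2V t ht.1))
  -- ### `Y(t) → 0` as `t → 0⁺`
  have hYlim : Tendsto Y (𝓝[>] 0) (𝓝 0) := by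
    have hT1 : Tendsto (fun t => ∫⁻ x in ball x₀ 3, ‖u t x - u₀ x‖ₑ ^ 2) (𝓝[>] 0) (𝓝 0) := by
      have h := h1.initial (closedBall x₀ 3) (isCompact_closedBall _ _)
      exact tendsto_of_tendsto_of_tendsto_of_le_of_le tendsto_const_nhds h (fun _ => zero_le)
        (fun t => lintegral_mono_set ball_subset_closedBall)
    have hT2 : Tendsto (fun t => eLpNorm (e t - u₀) 3 volume) (𝓝[>] 0) (𝓝 0) := by
      have h := tendsto_heatFlow_nhdsWithin_zero_holds (E := EuclideanSpace ℝ (Fin 3)) hu₀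
        (by norm_num) (by norm_num)
      have h' := h.mono_left (nhdsWithin_mono _ Ioi_subset_Ici_self)
      refine h'.congr fun t => ?_
      simp only [hedef, one_mul]
    have hT2' : Tendsto (fun t => 2 * (eLpNorm (e t - u₀) 3 volume ^ 2 * V ^ (1 / 3 : ℝ)))
        (𝓝[>] 0) (𝓝 0) := by
      have h1 : Tendsto (fun t => eLpNorm (e t - u₀) 3 volume ^ 2) (𝓝[>] 0) (𝓝 0) := by
        simpa using ENNReal.Tendsto.pow hT2 (n := 2)
      have h2 := ENNReal.Tendsto.mul_const h1 (Or.inr hV3fin)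
      rw [zero_mul] at h2
      have h3 := ENNReal.Tendsto.const_mul (a := 2) h2 (Or.inr (by norm_num))
      rw [mul_zero] at h3
      exact h3
    have hT1' : Tendsto (fun t => 2 * ∫⁻ x in ball x₀ 3, ‖u t x - u₀ x‖ₑ ^ 2) (𝓝[>] 0) (𝓝 0) := by
      have h3 := ENNReal.Tendsto.const_mul (a := 2) hT1 (Or.inr (by norm_num))
      rw [mul_zero] at h3
      exact h3
    have hsum := hT1'.add hT2'
    rw [add_zero] at hsum
    have hup : ∀ᶠ t in 𝓝[>] (0 : ℝ), ENNReal.ofReal (Y t) ≤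
        2 * (∫⁻ x in ball x₀ 3, ‖u t x - u₀ x‖ₑ ^ 2) +
          2 * (eLpNorm (e t - u₀) 3 volume ^ 2 * V ^ (1 / 3 : ℝ)) := by
      filter_upwards [self_mem_nhdsWithin] with t ht
      have ht' : 0 < t := ht
      have hme : AEStronglyMeasurable (fun x => e t x - u₀ x) (volume.restrict (ball x₀ 3)) :=
        ((he_cont t ht').aestronglyMeasurable.sub hu₀.1).restrict
      have hm : AEMeasurable (fun x => ‖e t x - u₀ x‖ₑ ^ 2) (volume.restrict (ball x₀ 3)) :=
        hme.aemeasurable.enorm.pow_const _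
      calc ENNReal.ofReal (Y t) ≤ ∫⁻ x in ball x₀ 3, ‖u t x - e t x‖ₑ ^ 2 := hYle t
        _ ≤ (2 * ∫⁻ x in ball x₀ 3, ‖u t x - u₀ x‖ₑ ^ 2) + 2 * ∫⁻ x in ball x₀ 3, ‖e t x - u₀ x‖ₑ ^ 2 :=
            setLIntegral_enorm_sub_sq_le hm
        _ ≤ _ := add_le_add le_rfl (mul_le_mul' le_rfl ?_)
      have h := setLIntegral_enorm_sq_le_eLpNorm_three_sq (B := ball x₀ 3) hme
      exact h
    have hofY : Tendsto (fun t => ENNReal.ofReal (Y t)) (𝓝[>] 0) (𝓝 0) :=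
      tendsto_of_tendsto_of_tendsto_of_le_of_le' tendsto_const_nhds hsum
        (Eventually.of_forall fun _ => zero_le) hup
    have h := (ENNReal.tendsto_toReal ENNReal.zero_ne_top).comp hofY
    rw [ENNReal.toReal_zero] at h
    refine h.congr fun t => ?_
    simp only [Function.comp_apply, ENNReal.toReal_ofReal (hY0 t)]
  -- ### `P ≥ 0`, `∫₀¹ P ≤ C_G M⁵`
  have hP0 : ∀ t, 0 ≤ P t := fun t => by positivity
  have hPle : ∫⁻ t in Ioo (0 : ℝ) 1, ENNReal.ofReal (P t) ≤ CG * (M : ℝ≥0∞) ^ 5 := by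
    calc ∫⁻ t in Ioo (0 : ℝ) 1, ENNReal.ofReal (P t)
        ≤ ∫⁻ t in Ioo (0 : ℝ) 1, eLpNorm (UnboundedOperators.heatExtension u₀ t) 5 volume ^ 5 := by
          refine lintegral_mono_ae ((ae_restrict_iff' measurableSet_Ioo).2 (Eventually.of_forall
            fun t ht => ?_))
          simp only [hPdef]
          rw [he_pos t ht.1, one_mul, ← ENNReal.toReal_pow]
          exact ENNReal.ofReal_toReal_le
      _ ≤ ∫⁻ t in Ioi (0 : ℝ), eLpNorm (UnboundedOperators.heatExtension u₀ t) 5 volume ^ 5 :=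
          lintegral_mono_set Ioo_subset_Ioi_self
      _ ≤ CG * eLpNorm u₀ 3 volume ^ 5 := hGiga hu₀
      _ ≤ CG * (M : ℝ≥0∞) ^ 5 := mul_le_mul' le_rfl (pow_le_pow_left' hM 5)
  have hPfin : ∫⁻ t in Ioo (0 : ℝ) 1, ENNReal.ofReal (P t) < ∞ := hPle.trans_lt hCGM.lt_top
  -- ### the windowed inequalities
  have hwin : ∀ δ τ : ℝ, 0 < δ → 4 * δ ≤ τ → τ < T₀ →
      ∫ t, ((1 / δ) * deriv Real.smoothTransition ((τ - δ - t) / δ)) * Y t ≤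
        (∫ t, ((1 / δ) * deriv Real.smoothTransition ((t - δ) / δ)) * Y t) +
        (∫ t, timePlateau δ τ t * Y t) +
        K₀ * (∫⁻ t, ENNReal.ofReal (timePlateau δ τ t * (P t * Y t))).toReal + a τ := by
    intro δ τ hδ hδτ hτ1
    have hτ : 0 < τ := by linarith
    have hC2 := h1.windowed_energy_bound hu₀ hdiv hG' hG'2 hLEI' hc₁ hK₀ hcut htri x₀ hδ hδτ hτ1
    obtain ⟨hint, hle⟩ := hrem T₀ u₀ u p G' x₀ hu₀ hM h1 hG' hE1 (hA3 G' hG') hPi τ hτ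
      (hτ1.le.trans hT₀1) hτ1.le
    have hsub : Ioo (δ / 2) τ ×ˢ ball x₀ 3 ⊆ Ioo 0 τ ×ˢ ball x₀ 3 :=
      prod_mono (Ioo_subset_Ioo (by linarith) le_rfl) Subset.rfl
    have hmn := setIntegral_mono_set hint
      (Eventually.of_forall fun z => by simp only [Pi.zero_apply]; positivity)
      (Eventually.of_forall fun z hz => hsub hz)
    exact hC2.trans (add_le_add le_rfl (hmn.trans hle))
  -- ### Grönwall (the real-variable layer)
  have hdecay := decay_of_window_strip (Y := Y) (P := P) (a := a) hT₀ hT₀1 hY0 hYm hYb hYlim hP0 hPfin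
    hK₀ ha0 hmono hwin
  -- ### conclusion on `B(x₀, 1)`, where `θ = 1`
  have hexp : Real.exp (1 + K₀ * (∫⁻ t in Ioo (0 : ℝ) 1, ENNReal.ofReal (P t)).toReal) ≤ Kexp := by
    rw [hKexp]
    refine Real.exp_le_exp.2 (add_le_add le_rfl (mul_le_mul_of_nonneg_left ?_ hK₀))
    exact ENNReal.toReal_mono hCGM hPle
  filter_upwards [hdecay, hslice, hE1, ae_restrict_mem measurableSet_Ioo] with t hdec hst hEt ht
  -- integrability of `θ |w(t)|²` at this time
  have hwm : AEStronglyMeasurable (fun x => u t x - e t x) volume :=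
    hst.1.sub (he_cont t ht.1).aestronglyMeasurable
  have hwfin : ∫⁻ x in ball x₀ 3, ‖u t x - e t x‖ₑ ^ 2 < ∞ := by
    have hm : AEMeasurable (fun x => ‖e t x - (0 : EuclideanSpace ℝ (Fin 3))‖ₑ ^ 2)
        (volume.restrict (ball x₀ 3)) :=
      (((he_cont t ht.1).aestronglyMeasurable.sub aestronglyMeasurable_const).aemeasurable.enorm.pow_const _)
    refine (setLIntegral_enorm_sub_sq_le hm).trans_lt ?_
    simp only [sub_zero]
    refine ENNReal.add_lt_top.2 ⟨ENNReal.mul_lt_top (by simp) (hEt.trans_lt ENNReal.coe_lt_top),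
      ENNReal.mul_lt_top (by simp) ((hM2V t ht.1).trans_lt ?_)⟩
    exact ENNReal.mul_lt_top (ENNReal.pow_lt_top ENNReal.coe_lt_top) hV3fin.lt_top
  have hIw : IntegrableOn (fun x => ‖u t x - e t x‖ ^ 2) (ball x₀ 3) volume := by
    refine ⟨(hwm.norm.pow 2).restrict, ?_⟩
    rw [hasFiniteIntegral_iff_enorm]
    refine lt_of_le_of_lt (lintegral_mono fun x => le_of_eq ?_) hwfin
    rw [Real.enorm_eq_ofReal (sq_nonneg _), ← ofReal_norm, ENNReal.ofReal_pow (norm_nonneg _)]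
  have hIθ : Integrable (fun x => cutoff (1 : ℝ) (x - x₀) ^ 2 * ‖u t x - e t x‖ ^ 2) volume := by
    have h1 : IntegrableOn (fun x => cutoff (1 : ℝ) (x - x₀) ^ 2 * ‖u t x - e t x‖ ^ 2) (ball x₀ 3) volume :=
      Integrable.bdd_mul hIw ((((contDiff_cutoff (E := EuclideanSpace ℝ (Fin 3)) (n := 0) 1).continuous.comp
        (continuous_id.sub continuous_const)).pow 2).aestronglyMeasurable)
        (Eventually.of_forall fun x => by
          rw [Real.norm_eq_abs, abs_of_nonneg (sq_nonneg _)]; exact hθ1 x)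
    rw [← integrable_indicator_iff measurableSet_ball] at h1
    refine h1.congr (Eventually.of_forall fun x => ?_)
    dsimp only
    by_cases hx : x ∈ ball x₀ 3
    · rw [indicator_of_mem hx]
    · rw [indicator_of_notMem hx, hθ0 x hx]; simp
  -- `∫_{B₁} |w|² ≤ Y(t)`
  have hB1 : ∫⁻ x in ball x₀ 1, ‖u t x - e t x‖ₑ ^ 2 ≤ ENNReal.ofReal (Y t) := by
    have hY : ENNReal.ofReal (Y t) = ∫⁻ x, ENNReal.ofReal (cutoff (1 : ℝ) (x - x₀) ^ 2 * ‖u t x - e t x‖ ^ 2) :=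
      ofReal_integral_eq_lintegral_ofReal hIθ (Eventually.of_forall fun x => by positivity)
    rw [hY, ← lintegral_indicator measurableSet_ball]
    refine lintegral_mono fun x => ?_
    by_cases hx : x ∈ ball x₀ 1
    · rw [indicator_of_mem hx, hθone x hx, one_pow, one_mul, ← ofReal_norm,
        ENNReal.ofReal_pow (norm_nonneg _)]
    · rw [indicator_of_notMem hx]; exact zero_le
  -- assemble
  have hYt : Y t ≤ a t * Kexp :=
    hdec.trans (mul_le_mul_of_nonneg_left hexp (ha0 t))
  have hrt : eLpNorm (u t - heatTest 1 u₀ t) 2 (volume.restrict (ball x₀ 1)) =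
      (∫⁻ x in ball x₀ 1, ‖u t x - e t x‖ₑ ^ 2) ^ (1 / 2 : ℝ) := by
    rw [eLpNorm_eq_lintegral_rpow_enorm_toReal two_ne_zero ENNReal.ofNat_ne_top]
    simp only [ENNReal.toReal_ofNat, ENNReal.rpow_ofNat, one_div]
    rfl
  rw [hrt]
  calc (∫⁻ x in ball x₀ 1, ‖u t x - e t x‖ₑ ^ 2) ^ (1 / 2 : ℝ)
      ≤ (ENNReal.ofReal (a t * Kexp)) ^ (1 / 2 : ℝ) :=
        ENNReal.rpow_le_rpow (hB1.trans (ENNReal.ofReal_le_ofReal hYt)) (by norm_num)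
    _ = ((Real.sqrt (a t * Kexp)).toNNReal : ℝ≥0∞) := by
        rw [ENNReal.ofReal_rpow_of_nonneg (mul_nonneg (ha0 t) hKexp0) (by norm_num),
          ← Real.sqrt_eq_rpow]
        rfl

end Main

end Literature.Analysis.FluidPDE

end
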